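import Mathlib
import Summits.Ventures.PercRepro2.IteratedBK

/-! # Strand splitting for the connection event (seat mine-b, cell pub-perc-repro2)
Two edge sets `E₁`, `E₂` sharing only the terminals `s, t` (`SharesOnlyTerminals`) carry `s–t` paths
independently: every carrying set splits (`carries_split`, walk splitting), the `k`-fold disjoint
occurrence of the connection event adds over the parts (`kDisj_split`, `kDisj_merge`,
`flowEvent_iff_flowIn`); the levels `F₁ = j` partition the space (`prob_inter_compl_flowIn_eq_sum`)
and on `F₁ = j` the total flow is `≥ k` iff the second part carries `k − j`
(`flowLevel_inter_flowEvent`).  `StrandSum.lean` derives the convolution identity and the strand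
reduction of row B2. -/

open Finset
namespace Summit.Ventures.PercRepro2
section Split

variable {V : Type*} {E : Type*} [Fintype E] [DecidableEq E]

/-- the parts `E₁`, `E₂` share only the terminals: a vertex other than `s`, `t` is an endpoint of
edges of at most one part -/
def SharesOnlyTerminals (ends : E → Sym2 V) (s t : V) (E₁ E₂ : Finset E) : Prop :=
  ∀ e₁ ∈ E₁, ∀ e₂ ∈ E₂, ∀ v, v ∈ ends e₁ → v ∈ ends e₂ → v = s ∨ v = t

omit [Fintype E] [DecidableEq E] in
/-- the relation is symmetric in the two parts -/
lemma SharesOnlyTerminals.symm {ends : E → Sym2 V} {s t : V} {E₁ E₂ : Finset E}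
    (h : SharesOnlyTerminals ends s t E₁ E₂) : SharesOnlyTerminals ends s t E₂ E₁ :=
  fun e₂ h₂ e₁ h₁ v hv₂ hv₁ => h e₁ h₁ e₂ h₂ v hv₁ hv₂

omit [Fintype E] in
/-- a path of `K`-edges that starts at a vertex touched by a `K ∩ E₁`-edge, avoids `s`, and meets
`t` at most as its end point stays inside `E₁` -/
lemma conn_part_of_walk {ends : E → Sym2 V} {s t : V} {E₁ E₂ : Finset E}
    (hE : SharesOnlyTerminals ends s t E₁ E₂) {K : Finset E} (hK : K ⊆ E₁ ∪ E₂) :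
    ∀ {u v : V} (w : (openGraph ends (ofFinset K)).Walk u v), w.IsPath → s ∉ w.support →
      (∀ x ∈ w.support, x ≠ v → x ≠ t) → (∃ e ∈ K ∩ E₁, u ∈ ends e) →
      Conn ends (ofFinset (K ∩ E₁)) u v := by
  intro u v w
  induction w with
  | nil => intro _ _ _ _; exact conn_refl _ _ _
  | @cons u u' v hadj w' ih =>
    intro hpath hs hvt he
    obtain ⟨e, heE, hue⟩ := he
    rw [SimpleGraph.Walk.cons_isPath_iff] at hpath
    rw [SimpleGraph.Walk.support_cons, List.mem_cons] at hs
    have hs' : s ∉ w'.support := fun h => hs (Or.inr h)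
    have hus : u ≠ s := fun h => hs (Or.inl h.symm)
    have huv : u ≠ v := fun h => hpath.2 (by rw [h]; exact SimpleGraph.Walk.end_mem_support _)
    have hut : u ≠ t := hvt u (by rw [SimpleGraph.Walk.support_cons]; exact List.mem_cons_self) huv
    have hvt' : ∀ x ∈ w'.support, x ≠ v → x ≠ t := fun x hx hxv =>
      hvt x (by rw [SimpleGraph.Walk.support_cons]; exact List.mem_cons_of_mem _ hx) hxv
    -- the edge realising the first step
    rw [openGraph_adj] at hadj
    obtain ⟨_, e', he'open, he'ends⟩ := hadj
    have he'K : e' ∈ K := ofFinset_eq_true_iff.1 he'open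
    have he'E₁ : e' ∈ E₁ := by
      rcases Finset.mem_union.1 (hK he'K) with h | h
      · exact h
      · exfalso
        have hu' : u ∈ ends e' := by rw [he'ends]; exact Sym2.mem_mk_left u u'
        rcases hE e (Finset.mem_of_mem_inter_right heE) e' h u hue hu' with h1 | h1
        · exact hus h1
        · exact hut h1
    have hadj' : OpenAdj ends (ofFinset (K ∩ E₁)) u u' :=
      ⟨e', ofFinset_eq_true_iff.2 (Finset.mem_inter.2 ⟨he'K, he'E₁⟩), he'ends⟩
    have hu'e : u' ∈ ends e' := by rw [he'ends]; exact Sym2.mem_mk_right u u'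
    have hrest := ih hpath.1 hs' hvt' ⟨e', Finset.mem_inter.2 ⟨he'K, he'E₁⟩, hu'e⟩
    exact conn_trans (conn_of_openAdj hadj') hrest

omit [Fintype E] in
/-- **a carrying set splits**: if `K ⊆ E₁ ∪ E₂` carries `s` to `t` and the parts share only the
terminals, then `K ∩ E₁` or `K ∩ E₂` carries `s` to `t` -/
lemma carries_split {ends : E → Sym2 V} {s t : V} (hst : s ≠ t) {E₁ E₂ : Finset E}
    (hE : SharesOnlyTerminals ends s t E₁ E₂) {K : Finset E} (hK : K ⊆ E₁ ∪ E₂)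
    (hc : Carries ends K s t) : Carries ends (K ∩ E₁) s t ∨ Carries ends (K ∩ E₂) s t := by
  classical
  obtain ⟨w₀⟩ := hc
  obtain ⟨w, hw⟩ := w₀.toPath
  cases w with
  | nil => exact absurd rfl hst
  | @cons _ v _ hadj w' =>
    rw [SimpleGraph.Walk.cons_isPath_iff] at hw
    have hadj₀ := hadj
    rw [openGraph_adj] at hadj
    obtain ⟨_, e, heopen, heends⟩ := hadj
    have heK : e ∈ K := ofFinset_eq_true_iff.1 heopen
    have hve : v ∈ ends e := by rw [heends]; exact Sym2.mem_mk_right s v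
    rcases Finset.mem_union.1 (hK heK) with h₁ | h₂
    · left
      have hconn := conn_part_of_walk hE hK w' hw.1 hw.2 (fun _ _ hx => hx)
        ⟨e, Finset.mem_inter.2 ⟨heK, h₁⟩, hve⟩
      have hadj' : OpenAdj ends (ofFinset (K ∩ E₁)) s v :=
        ⟨e, ofFinset_eq_true_iff.2 (Finset.mem_inter.2 ⟨heK, h₁⟩), heends⟩
      exact conn_trans (conn_of_openAdj hadj') hconn
    · right
      have hK' : K ⊆ E₂ ∪ E₁ := by rw [Finset.union_comm]; exact hK
      have hconn := conn_part_of_walk hE.symm hK' w' hw.1 hw.2 (fun _ _ hx => hx)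
        ⟨e, Finset.mem_inter.2 ⟨heK, h₂⟩, hve⟩
      have hadj' : OpenAdj ends (ofFinset (K ∩ E₂)) s v :=
        ⟨e, ofFinset_eq_true_iff.2 (Finset.mem_inter.2 ⟨heK, h₂⟩), heends⟩
      exact conn_trans (conn_of_openAdj hadj') hconn

end Split

section Flows

variable {V : Type*} {E : Type*} [Fintype E] [DecidableEq E]

omit [Fintype E] in
/-- disjoint witness families merge: `i` disjoint witnesses in `T₁` and `j` in `T₂` give `i + j` in `T₁ ∪ T₂` -/
lemma kDisj_merge {A : Finset E → Prop} : ∀ (i j : ℕ) {T₁ T₂ : Finset E}, Disjoint T₁ T₂ →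
    kDisj A i T₁ → kDisj A j T₂ → kDisj A (i + j) (T₁ ∪ T₂)
  | 0, j, T₁, T₂, _, _, h₂ => by
      rw [Nat.zero_add]
      exact incr_kDisj A j Finset.subset_union_right h₂
  | i + 1, j, T₁, T₂, hd, h₁, h₂ => by
      obtain ⟨K, L, hK, hL, hKL, hA, hB⟩ := h₁
      have hL' : kDisj A i L := hB L le_rfl
      have hd' : Disjoint L T₂ := Finset.disjoint_of_subset_left hL hd
      have hrec := kDisj_merge i j hd' hL' h₂
      have e : i + 1 + j = i + j + 1 := by omega
      rw [e]
      exact ⟨K, L ∪ T₂, hK.trans Finset.subset_union_left, Finset.union_subset_union hL le_rfl,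
        Finset.disjoint_union_right.2 ⟨hKL, Finset.disjoint_of_subset_left hK hd⟩, hA,
        fun T hT => incr_kDisj A (i + j) hT hrec⟩

omit [Fintype E] in
/-- `k` disjoint witnesses of `A` contained in `S` restrict to `k` disjoint witnesses of
`S ↦ A (S ∩ E₁)` inside `S` and conversely: the flow inside the part `E₁` -/
lemma kDisj_inter_iff {V : Type*} (ends : E → Sym2 V) (s t : V) (E₁ : Finset E) :
    ∀ (k : ℕ) (S : Finset E),
      kDisj (fun S => Carries ends S s t) k (S ∩ E₁) ↔ kDisj (fun S => Carries ends (S ∩ E₁) s t) k S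
  | 0, S => Iff.rfl
  | k + 1, S => by
      constructor
      · rintro ⟨K, L, hK, hL, hKL, hA, hB⟩
        refine ⟨K, L, hK.trans Finset.inter_subset_left, hL.trans Finset.inter_subset_left, hKL, ?_, ?_⟩
        · intro T hT
          apply hA
          intro e he
          exact Finset.mem_inter.2 ⟨hT he, Finset.mem_of_mem_inter_right (hK he)⟩
        · intro T hT
          rw [← kDisj_inter_iff ends s t E₁ k T]
          apply incr_kDisj _ k _ (hB L le_rfl)
          intro e he
          exact Finset.mem_inter.2 ⟨hT he, Finset.mem_of_mem_inter_right (hL he)⟩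
      · rintro ⟨K, L, hK, hL, hKL, hA, hB⟩
        refine ⟨K ∩ E₁, L ∩ E₁, Finset.inter_subset_inter hK le_rfl, Finset.inter_subset_inter hL le_rfl,
          Finset.disjoint_of_subset_left Finset.inter_subset_left
            (Finset.disjoint_of_subset_right Finset.inter_subset_left hKL), ?_, ?_⟩
        · intro T hT
          have h := hA (T ∪ K) Finset.subset_union_right
          apply Carries.mono _ h
          intro e he
          rw [Finset.mem_inter, Finset.mem_union] at he
          rcases he.1 with h1 | h1
          · exact h1
          · exact hT (Finset.mem_inter.2 ⟨h1, he.2⟩)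
        · intro T hT
          have h := hB (T ∪ L) Finset.subset_union_right
          rw [← kDisj_inter_iff ends s t E₁ k] at h
          apply incr_kDisj _ k _ h
          intro e he
          rw [Finset.mem_inter, Finset.mem_union] at he
          rcases he.1 with h1 | h1
          · exact h1
          · exact hT (Finset.mem_inter.2 ⟨h1, he.2⟩)

omit [Fintype E] in
/-- **the flow splits over two parts sharing only the terminals** -/
lemma kDisj_split {ends : E → Sym2 V} {s t : V} (hst : s ≠ t) {E₁ E₂ : Finset E}
    (hE : SharesOnlyTerminals ends s t E₁ E₂) :
    ∀ (k : ℕ) {S : Finset E}, S ⊆ E₁ ∪ E₂ → kDisj (fun S => Carries ends S s t) k S →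
      ∃ j ≤ k, kDisj (fun S => Carries ends S s t) j (S ∩ E₁) ∧
        kDisj (fun S => Carries ends S s t) (k - j) (S ∩ E₂)
  | 0, S, _, _ => ⟨0, le_rfl, trivial, trivial⟩
  | k + 1, S, hS, h => by
      obtain ⟨K, L, hK, hL, hKL, hA, hB⟩ := h
      have hKc : Carries ends K s t := hA K le_rfl
      have hLk : kDisj (fun S => Carries ends S s t) k L := hB L le_rfl
      obtain ⟨j, hj, hL₁, hL₂⟩ := kDisj_split hst hE k (hL.trans hS) hLk
      rcases carries_split hst hE (hK.trans hS) hKc with h₁ | h₂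
      · refine ⟨j + 1, by omega, ?_, ?_⟩
        · exact ⟨K ∩ E₁, L ∩ E₁, Finset.inter_subset_inter hK le_rfl, Finset.inter_subset_inter hL le_rfl,
            Finset.disjoint_of_subset_left Finset.inter_subset_left
              (Finset.disjoint_of_subset_right Finset.inter_subset_left hKL),
            fun T hT => Carries.mono hT h₁, fun T hT => incr_kDisj _ j hT hL₁⟩
        · have e : k + 1 - (j + 1) = k - j := by omega
          rw [e]
          exact incr_kDisj _ (k - j) (Finset.inter_subset_inter hL le_rfl) hL₂
      · refine ⟨j, by omega, ?_, ?_⟩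
        · exact incr_kDisj _ j (Finset.inter_subset_inter hL le_rfl) hL₁
        · have e : k + 1 - j = k - j + 1 := by omega
          rw [e]
          exact ⟨K ∩ E₂, L ∩ E₂, Finset.inter_subset_inter hK le_rfl, Finset.inter_subset_inter hL le_rfl,
            Finset.disjoint_of_subset_left Finset.inter_subset_left
              (Finset.disjoint_of_subset_right Finset.inter_subset_left hKL),
            fun T hT => Carries.mono hT h₂, fun T hT => incr_kDisj _ (k - j) hT hL₂⟩

/-- **the flow inside a part**: `k` pairwise edge-disjoint open `s–t` paths using only edges of `E₁` -/
def flowIn (ends : E → Sym2 V) (s t : V) (E₁ : Finset E) (k : ℕ) : Set (Config E) :=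
  {ω | kDisj (fun S => Carries ends S s t) k (openSet ω ∩ E₁)}

/-- the flow in the whole edge set is `flowEvent` -/
theorem flowIn_univ (ends : E → Sym2 V) (s t : V) (k : ℕ) :
    flowIn ends s t Finset.univ k = flowEvent ends s t k := by
  ext ω; simp [flowIn, flowEvent]

/-- **parallel composition**: with `E = E₁ ⊔ E₂` sharing only the terminals,
`F ≥ k ⟺ ∃ j ≤ k, F₁ ≥ j ∧ F₂ ≥ k − j` -/
theorem flowEvent_iff_flowIn {ends : E → Sym2 V} {s t : V} (hst : s ≠ t) {E₁ E₂ : Finset E}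
    (hE : SharesOnlyTerminals ends s t E₁ E₂) (hdisj : Disjoint E₁ E₂) (hcov : E₁ ∪ E₂ = Finset.univ)
    (k : ℕ) (ω : Config E) :
    ω ∈ flowEvent ends s t k ↔ ∃ j ≤ k, ω ∈ flowIn ends s t E₁ j ∧ ω ∈ flowIn ends s t E₂ (k - j) := by
  constructor
  · intro h
    obtain ⟨j, hj, h₁, h₂⟩ := kDisj_split hst hE k (by rw [hcov]; exact Finset.subset_univ _) h
    exact ⟨j, hj, h₁, h₂⟩
  · rintro ⟨j, hj, h₁, h₂⟩
    have hd : Disjoint (openSet ω ∩ E₁) (openSet ω ∩ E₂) :=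
      Finset.disjoint_of_subset_left Finset.inter_subset_right
        (Finset.disjoint_of_subset_right Finset.inter_subset_right hdisj)
    have hm := kDisj_merge j (k - j) hd h₁ h₂
    have e : j + (k - j) = k := by omega
    rw [e] at hm
    have hu : openSet ω ∩ E₁ ∪ openSet ω ∩ E₂ = openSet ω := by
      rw [← Finset.inter_union_distrib_left, hcov, Finset.inter_univ]
    rw [hu] at hm
    exact hm

end Flows

section Probability

variable {V : Type*} {E : Type*} [Fintype E] [DecidableEq E]

omit [Fintype E] in
/-- without open edges nothing is carried (for `s ≠ t`) -/
lemma not_carries_empty {ends : E → Sym2 V} {s t : V} (hst : s ≠ t) : ¬ Carries ends (∅ : Finset E) s t := by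
  intro h
  have hbot : openGraph ends (ofFinset (∅ : Finset E)) = ⊥ := by
    ext u v
    rw [openGraph_adj]
    simp only [SimpleGraph.bot_adj, iff_false, not_and]
    rintro _ ⟨e, he, _⟩
    rw [ofFinset_eq_true_iff] at he
    exact absurd he (Finset.notMem_empty e)
  unfold Carries Conn at h
  rw [hbot, SimpleGraph.reachable_bot] at h
  exact hst h

omit [Fintype E] in
/-- `k` disjoint carrying sets inside `S` need `k ≤ |S|` -/
lemma kDisj_le_card {ends : E → Sym2 V} {s t : V} (hst : s ≠ t) :
    ∀ (k : ℕ) {S : Finset E}, kDisj (fun S => Carries ends S s t) k S → k ≤ S.card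
  | 0, _, _ => Nat.zero_le _
  | k + 1, S, h => by
      obtain ⟨K, L, hK, hL, hKL, hA, hB⟩ := h
      have hKne : K.Nonempty := by
        rw [Finset.nonempty_iff_ne_empty]
        rintro rfl
        exact not_carries_empty hst (hA ∅ le_rfl)
      have h1 := kDisj_le_card hst k (hB L le_rfl)
      have h2 : L.card + K.card ≤ S.card := by
        rw [← Finset.card_union_of_disjoint hKL.symm]
        exact Finset.card_le_card (Finset.union_subset hL hK)
      have h3 : 1 ≤ K.card := Finset.card_pos.2 hKne
      omega

omit [Fintype E] [DecidableEq E] in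
/-- `k + 1` disjoint witnesses contain `k` -/
lemma kDisj_of_succ {A : Finset E → Prop} {k : ℕ} {S : Finset E} (h : kDisj A (k + 1) S) : kDisj A k S := by
  obtain ⟨_, L, _, hL, _, _, hB⟩ := h
  exact incr_kDisj A k hL (hB L le_rfl)

/-- the flow events are nested -/
lemma flowIn_succ_subset (ends : E → Sym2 V) (s t : V) (E₁ : Finset E) (k : ℕ) :
    flowIn ends s t E₁ (k + 1) ⊆ flowIn ends s t E₁ k := fun _ h => kDisj_of_succ h

/-- `F ≥ 0` always -/
lemma flowIn_zero (ends : E → Sym2 V) (s t : V) (E₁ : Finset E) : flowIn ends s t E₁ 0 = Set.univ := by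
  ext ω; simp [flowIn, kDisj]

/-- the flow in a part is at most its size -/
lemma flowIn_eq_empty {ends : E → Sym2 V} {s t : V} (hst : s ≠ t) (E₁ : Finset E) {k : ℕ}
    (hk : E₁.card < k) : flowIn ends s t E₁ k = ∅ := by
  ext ω
  simp only [flowIn, Set.mem_setOf_eq, Set.mem_empty_iff_false, iff_false]
  intro h
  have := kDisj_le_card hst k h
  have h2 : (openSet ω ∩ E₁).card ≤ E₁.card := Finset.card_le_card Finset.inter_subset_right
  omega

/-- the flow in a part depends only on the edges of the part -/
lemma dependsOn_flowIn (ends : E → Sym2 V) (s t : V) (E₁ : Finset E) (k : ℕ) :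
    DependsOn (· ∈ flowIn ends s t E₁ k) (E₁ : Set E) := by
  intro ω ω' h
  have : openSet ω ∩ E₁ = openSet ω' ∩ E₁ := by
    ext e
    simp only [openSet, Finset.mem_inter, Finset.mem_filter, Finset.mem_univ, true_and]
    constructor
    · rintro ⟨h1, h2⟩; exact ⟨by rw [← h e h2]; exact h1, h2⟩
    · rintro ⟨h1, h2⟩; exact ⟨by rw [h e h2]; exact h1, h2⟩
  simp only [flowIn, Set.mem_setOf_eq, this]

/-- the level `F₁ = j` -/
def flowLevel (ends : E → Sym2 V) (s t : V) (E₁ : Finset E) (j : ℕ) : Set (Config E) :=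
  flowIn ends s t E₁ j \ flowIn ends s t E₁ (j + 1)

/-- the level `F₁ = j` depends only on the edges of the part -/
lemma dependsOn_flowLevel (ends : E → Sym2 V) (s t : V) (E₁ : Finset E) (j : ℕ) :
    DependsOn (· ∈ flowLevel ends s t E₁ j) (E₁ : Set E) := by
  have h := dependsOn_inter (dependsOn_flowIn ends s t E₁ j)
    (dependsOn_compl (dependsOn_flowIn ends s t E₁ (j + 1)))
  rw [Set.union_self] at h
  exact h

/-- **levels partition**: `P(A ∩ {F₁ < N+1}) = Σ_{j ≤ N} P(A ∩ {F₁ = j})` -/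
lemma prob_inter_compl_flowIn_eq_sum (p : E → ℝ) (ends : E → Sym2 V) (s t : V) (E₁ : Finset E)
    (A : Set (Config E)) : ∀ N : ℕ,
    prob p (A ∩ (flowIn ends s t E₁ (N + 1))ᶜ) = ∑ j ∈ Finset.range (N + 1), prob p (A ∩ flowLevel ends s t E₁ j)
  | 0 => by
      rw [Finset.sum_range_one]
      congr 1
      ext ω
      simp [flowLevel, flowIn_zero]
  | N + 1 => by
      rw [Finset.sum_range_succ, ← prob_inter_compl_flowIn_eq_sum p ends s t E₁ A N]
      rw [← prob_union_of_disjoint]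
      · congr 1
        ext ω
        simp only [Set.mem_inter_iff, Set.mem_compl_iff, Set.mem_union, flowLevel, Set.mem_sdiff]
        have hsub := flowIn_succ_subset ends s t E₁ (N + 1)
        constructor
        · rintro ⟨hA, hn⟩
          by_cases h1 : ω ∈ flowIn ends s t E₁ (N + 1)
          · exact Or.inr ⟨hA, h1, hn⟩
          · exact Or.inl ⟨hA, h1⟩
        · rintro (⟨hA, hn⟩ | ⟨hA, _, hn⟩)
          · exact ⟨hA, fun h => hn (hsub h)⟩
          · exact ⟨hA, hn⟩
      · rw [Set.disjoint_left]
        rintro ω ⟨_, hn⟩ ⟨_, h1, _⟩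
        exact hn h1

/-- on the level `F₁ = j` the total flow is `≥ k` iff the second part carries `k − j` -/
lemma flowLevel_inter_flowEvent {ends : E → Sym2 V} {s t : V} (hst : s ≠ t) {E₁ E₂ : Finset E}
    (hE : SharesOnlyTerminals ends s t E₁ E₂) (hdisj : Disjoint E₁ E₂) (hcov : E₁ ∪ E₂ = Finset.univ)
    (k j : ℕ) :
    flowLevel ends s t E₁ j ∩ flowEvent ends s t k = flowLevel ends s t E₁ j ∩ flowIn ends s t E₂ (k - j) := by
  ext ω
  simp only [Set.mem_inter_iff, flowLevel, Set.mem_sdiff]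
  constructor
  · rintro ⟨⟨hj, hj1⟩, hk⟩
    refine ⟨⟨hj, hj1⟩, ?_⟩
    obtain ⟨i, hi, h₁, h₂⟩ := (flowEvent_iff_flowIn hst hE hdisj hcov k ω).1 hk
    -- `i ≤ j` since `F₁ = j`
    have hij : i ≤ j := by
      by_contra hlt
      have hlt' : j + 1 ≤ i := Nat.lt_of_not_le hlt
      have : ω ∈ flowIn ends s t E₁ (j + 1) := by
        have hmono : ∀ n, ω ∈ flowIn ends s t E₁ (j + 1 + n) → ω ∈ flowIn ends s t E₁ (j + 1) := by
          intro n
          induction n with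
          | zero => intro h; simpa using h
          | succ n ih => intro h; exact ih (flowIn_succ_subset ends s t E₁ _ h)
        have e : j + 1 + (i - (j + 1)) = i := by omega
        apply hmono (i - (j + 1))
        rw [e]; exact h₁
      exact hj1 this
    -- `F₂ ≥ k − i ≥ k − j`
    have hmono : ∀ n, ω ∈ flowIn ends s t E₂ (k - j + n) → ω ∈ flowIn ends s t E₂ (k - j) := by
      intro n
      induction n with
      | zero => intro h; simpa using h
      | succ n ih => intro h; exact ih (flowIn_succ_subset ends s t E₂ _ h)
    have e : k - j + (k - i - (k - j)) = k - i := by omega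
    apply hmono (k - i - (k - j))
    rw [e]; exact h₂
  · rintro ⟨⟨hj, hj1⟩, h₂⟩
    refine ⟨⟨hj, hj1⟩, ?_⟩
    rw [flowEvent_iff_flowIn hst hE hdisj hcov k ω]
    refine ⟨min j k, min_le_right _ _, ?_, ?_⟩
    · -- `F₁ ≥ j ≥ min j k`
      have hmono : ∀ n, ω ∈ flowIn ends s t E₁ (min j k + n) → ω ∈ flowIn ends s t E₁ (min j k) := by
        intro n
        induction n with
        | zero => intro h; simpa using h
        | succ n ih => intro h; exact ih (flowIn_succ_subset ends s t E₁ _ h)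
      have e : min j k + (j - min j k) = j := by omega
      apply hmono (j - min j k)
      rw [e]; exact hj
    · have e : k - min j k = k - j := by omega
      rw [e]; exact h₂

end Probability
end Summit.Ventures.PercRepro2
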